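import Summits.HubbardSuperconductivity.HubbardSuperconductivity.Theorems.CooperPairDMottWalkCooperPairDMottPlaquetteGCWindowSectorBounds
import Summits.HubbardSuperconductivity.HubbardSuperconductivity.Theorems.CooperPairDMottWalkCooperPairDMottPlaquetteGCWindowSectorBounds31
import Summits.HubbardSuperconductivity.HubbardSuperconductivity.Theorems.CooperPairDMottWalkCooperPairDMottPlaquetteGCWindowSectorBounds22
import Summits.HubbardSuperconductivity.HubbardSuperconductivity.Theorems.CooperPairDMottWalkCooperPairDMottPairTrialCeilingWindowReduction

/-!
# Route `CooperPairDMottWalk`, crux `CooperPairDMott`: the plaquette grand-canonical window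

Stub `stub_plaquetteGCWindow` of the line `Cruxes/CooperPairDMott/Lines/birth.lean` (item
stmt-HubbardSuperconductivity-1177), the plaquette datum consumed by the pair ceiling
(`pairTrialCeiling_of_plaquetteGCWindow`): for every `U ∈ [2, 4]` there are `μ` and `γ > 0` with
`Re⟨v, (h − μN) v⟩ ≥ (e₄⁰ − 4μ + γ)‖v‖²` for every `v` orthogonal to the `(4, 0)` ground space of the
isolated `2 × 2` Hubbard plaquette `h = hubbardTorus 2 2 1 U` (`e₄⁰ = minEnergyOn h (szSector 4 0)`):
the 4-electron singlet is the unique grand-canonical ground state of `h − μN`, with a gap. Witnesses: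
`μ = U/2` (the particle–hole symmetric chemical potential) and `γ = 1/20`.

Proof (certified exact diagonalisation; only kernel-checked integer arithmetic is trusted). By the
block reduction `plaquetteGCWindow_of_sectorBounds` (`…PairTrialCeilingWindowReduction`) it suffices
to bound the form of `h` from below (i) by `e₄⁰ + γ + μ(a + b − 4)` on every sector
`(N↑, N↓) = (a, b) ≠ (2, 2)` and (ii) by `e₄⁰ + γ` on the `(2, 2)` vectors orthogonal to the ground
eigenvectors. (ii) is `gcWindow_inSector` (`…SectorBounds22`: rank-one deflated Gram certificates and
the deflation lemma). (i) is `gcWindow_offSector` below: for `a, b ≤ 4` (otherwise the sector is `{0}`)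
the 24 plaquette-level sector bounds `plaq{ab}_lb` of `…SectorBounds` (Gershgorin, margins `≥ 0.5`)
and `…SectorBounds31` (Gram certificates for `(3,1)`, `(1,3)`, `(3,2)`, `(2,3)`; the binding
constraint is the `S = 1` level `e₄⁰ +` spin gap `0.14–0.30` of `(3,1)`, `(1,3)`) are compared with
the affine variational upper bound `e4_le_2` on `e₄⁰` (`…PlaquettePairBinding`); both sides are affine
in `U`, so `linarith` closes each sector from the endpoint inequalities.
Numerically (uncertified, orientation): `e₄⁰ = −2.828 … −2.103`, spin gap `0.143 … 0.296` on `[2, 4]`.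

Sources: W.-F. Tsai, S. A. Kivelson, PRB 73 (2006) 214510, Table I; E. H. Lieb, PRL 62 (1989) 1201.
-/

set_option linter.dupNamespace false

noncomputable section

namespace Summit.HubbardSuperconductivity.HubbardSuperconductivity.Theorems.CooperPairDMottWalk

open Literature.MathematicalPhysics.QuantumLattice Literature.MathematicalPhysics.QuantumLattice.TwoSpecies
open Matrix Finset
open scoped ComplexOrder

/-! ### (i) Off the half-filled sector -/

/-- `|FermionTorus 2 2| = 4`. [folklore] -/
theorem card_fermionTorus_two_two : Fintype.card (FermionTorus 2 2) = 4 := card_plaquetteSite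

/-- **(i) Off the half-filled sector**: `(e₄⁰ + 1/20 + (U/2)(a + b − 4))‖v‖² ≤ Re⟨v, h v⟩` on every
sector `(a, b) ≠ (2, 2)` of the plaquette, `U ∈ [2, 4]` (24 certified sector bounds against the affine
upper bound `e4_le_2` on `e₄⁰`; the sectors with `a > 4` or `b > 4` are `{0}`). [folklore] -/
theorem gcWindow_offSector {U : ℝ} (hU2 : 2 ≤ U) (hU4 : U ≤ 4) :
    ∀ a b : ℕ, (a, b) ≠ (2, 2) → ∀ v : Fock (Orb (FermionTorus 2 2)), IsInSector a b v →
      ((hubbardTorus 2 2 1 U).minEnergyOn (szSector 4 0) + 1 / 20 + U / 2 * (((a + b : ℕ) : ℝ) - 4)) *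
          (star v ⬝ᵥ v).re ≤ (star v ⬝ᵥ (hubbardTorus 2 2 1 U *ᵥ v)).re := by
  intro a b hab v hv
  rw [← plaquetteHamiltonian_eq_hubbardTorus]
  by_cases hv0 : v = 0
  · subst hv0; simp
  obtain ⟨ha, hb⟩ := le_card_of_isInSector hv hv0
  rw [card_fermionTorus_two_two] at ha hb
  have e4 := e4_le_2 U
  interval_cases a <;> interval_cases b
  · exact formBound_weaken (by push_cast; linarith) (plaq00_lb hU2 v hv)
  · exact formBound_weaken (by push_cast; linarith) (plaq01_lb hU2 v hv)
  · exact formBound_weaken (by push_cast; linarith) (plaq02_lb hU2 v hv)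
  · exact formBound_weaken (by push_cast; linarith) (plaq03_lb hU2 v hv)
  · exact formBound_weaken (by push_cast; linarith) (plaq04_lb hU2 v hv)
  · exact formBound_weaken (by push_cast; linarith) (plaq10_lb hU2 v hv)
  · exact formBound_weaken (by push_cast; linarith) (plaq11_lb hU2 v hv)
  · exact formBound_weaken (by push_cast; linarith) (plaq12_lb hU2 hU4 v hv)
  · exact formBound_weaken (by push_cast; linarith) (plaq13_lb hU2 hU4 v hv)
  · exact formBound_weaken (by push_cast; linarith) (plaq14_lb hU2 hU4 v hv)
  · exact formBound_weaken (by push_cast; linarith) (plaq20_lb hU2 v hv)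
  · exact formBound_weaken (by push_cast; linarith) (plaq21_lb hU2 hU4 v hv)
  · exact absurd rfl hab
  · exact formBound_weaken (by push_cast; linarith) (plaq23_lb hU2 hU4 v hv)
  · exact formBound_weaken (by push_cast; linarith) (plaq24_lb hU2 hU4 v hv)
  · exact formBound_weaken (by push_cast; linarith) (plaq30_lb hU2 v hv)
  · exact formBound_weaken (by push_cast; linarith) (plaq31_lb hU2 hU4 v hv)
  · exact formBound_weaken (by push_cast; linarith) (plaq32_lb hU2 hU4 v hv)
  · exact formBound_weaken (by push_cast; linarith) (plaq33_lb hU2 hU4 v hv)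
  · exact formBound_weaken (by push_cast; linarith) (plaq34_lb hU2 hU4 v hv)
  · exact formBound_weaken (by push_cast; linarith) (plaq40_lb hU2 v hv)
  · exact formBound_weaken (by push_cast; linarith) (plaq41_lb hU2 hU4 v hv)
  · exact formBound_weaken (by push_cast; linarith) (plaq42_lb hU2 hU4 v hv)
  · exact formBound_weaken (by push_cast; linarith) (plaq43_lb hU2 hU4 v hv)
  · exact formBound_weaken (by push_cast; linarith) (plaq44_lb hU2 hU4 v hv)

/-! ### The stub -/

/-- **Stub GCW of the line `CooperPairDMott/birth` — the plaquette grand-canonical window**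
(P-datum; certified computation). For every `U ∈ [2, 4]` there are a chemical potential `μ` and a
gap `γ > 0` such that the isolated plaquette `h = hubbardTorus 2 2 1 U` satisfies
`Re⟨v, (h − μN)v⟩ ≥ (e₄⁰ − 4μ + γ)‖v‖²` for every `v` orthogonal to the `(4, 0)` ground space: the
4-electron singlet is the unique grand-canonical ground state, with a gap. Witnesses `μ = U/2`,
`γ = 1/20`; the certified sector bounds `gcWindow_offSector`, `gcWindow_inSector` fed into the block
reduction `plaquetteGCWindow_of_sectorBounds`. Tsai–Kivelson, PRB 73 (2006) 214510, Table I (plaquette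
spectra; the binding constraint is the spin gap `0.14–0.30`). [cite: TsaiKivelson2006, Table I] -/
theorem stub_plaquetteGCWindow :
    ∀ U ∈ Set.Icc (2 : ℝ) 4, ∃ μ γ : ℝ, 0 < γ ∧
      ∀ v : Fock (Orb (FermionTorus 2 2)),
        (∀ w ∈ (szSector 4 0 : Submodule ℂ (Fock (Orb (FermionTorus 2 2)))),
          hubbardTorus 2 2 1 U *ᵥ w = (((hubbardTorus 2 2 1 U).minEnergyOn (szSector 4 0) : ℝ) : ℂ) • w →
            star w ⬝ᵥ v = 0) →
        ((hubbardTorus 2 2 1 U).minEnergyOn (szSector 4 0) - 4 * μ + γ) * (star v ⬝ᵥ v).re ≤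
          (star v ⬝ᵥ ((hubbardTorus 2 2 1 U - (μ : ℂ) • totalNumber) *ᵥ v)).re := by
  intro U hU
  exact ⟨U / 2, 1 / 20, by norm_num, plaquetteGCWindow_of_sectorBounds U (U / 2) (1 / 20)
    (gcWindow_offSector hU.1 hU.2) (gcWindow_inSector hU.1 hU.2)⟩

end Summit.HubbardSuperconductivity.HubbardSuperconductivity.Theorems.CooperPairDMottWalk

end
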